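import Summits.BirchSwinnertonDyer.Rank1Residual.Additive.LevelToLayerZero
import Literature.NumberTheory.EllipticCurves.KummerMap
import Literature.NumberTheory.EllipticCurves.SelmerCorankProofs
import Literature.NumberTheory.EllipticCurves.PointDivisibilityProofs
import HarnessLib

/-!
# Bridge: the level-`p^m` Kummer class pushed to `E[p^∞]`-coefficients IS the tree's `kummerMapLevel`
# class — `H¹(ι_m)(κ_{p^m}(P)) = κ_m(P)` in `H¹(K, E[p^∞])` (cell `b2b-bsdres`, CLASS-CLOSURE lane,
# class O10 — x1b GEN 43, class lead; file 116 of the series: Step 1a of `HMW-COUNT-PLAN`, the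
# compatible system `x_m = [κ_m(P)]` for file 115 via `kummerMapLevel_level`)

HONEST FRAMING (cell `b2b-bsdres`, run/shared/lean/b2b/bsd-rank1-residual/, verbatim in every
file): the goal of the cell is to DELETE the COMBINATION-SHAPED residual classes of the
Birch–Swinnerton-Dyer formula for ALL analytic-rank `≤ 1` elliptic curves over `ℚ` — "full BSD
formula for every rank `≤ 1` curve in class `C`" assembled STRICTLY from published theorems — so
that the rank-`≤ 1` remainder becomes exactly the CONSTRUCTION-SHAPED classes, which are TYPED
(missing-input `Prop`s), NOT attempted. This is not "finishing BSD". CLASS-CLOSURE lane: prove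
what is provable now; no claim beyond stated classes; research routes on CONSTRUCTION-SHAPED X12 / O10.
THIS FILE: TOOL THEOREMS ONLY (cohomology bookkeeping) — no definition, no named Literature fact, no
`sorry`, axioms standard; nothing is booked; nothing about `BSD(W, p)` of any pair is claimed.

## What

For `W/K` elliptic over any field, `p` prime, `m : ℕ`, `P ∈ W(K)`:
* `map_primaryInclusion_kummerMapTorsion_eq_kummerMapLevel`:
  `H¹(ι_m)(kummerMapTorsion W (p^m) _ P) = kummerMapLevel W p hdiv m P` — both are the class of
  `σ ↦ σ•Q − Q` for a `p^m`-th root `Q` of `P`;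
* `addOrderOf_levelToLayerZero_kummerMapTorsion_eq`: `ord Ψ_m(κ_{p^m}(P)) = p^m` for a point generating
  modulo `p^m` ((MW) input `hord`), when `E[p^∞]^{Γ_K} = 0` (Step 1b);
* `nsmul_map_primaryInclusion_kummerMapTorsion_succ`: the compatible system
  `p • H¹(ι_{m+1})(κ_{p^{m+1}}(P)) = H¹(ι_m)(κ_{p^m}(P))` (from `kummerMapLevel_level`), i.e. the
  classes `x_m = [κ_m(P)] ∈ H¹(K, E[p^∞])` form the line consumed by file 115.

References: [SilvermanAEC2009] VIII.§2; [GreenbergLNM1716] §2 p. 62 (`E(K) ⊗ ℚ_p/ℤ_p = lim E(K)/p^n`).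
-/

noncomputable section

open scoped Classical

open WeierstrassCurve Literature.NumberTheory.EllipticCurves Literature.NumberTheory.GaloisRepresentations
  ZpExtension
open Summit.BirchSwinnertonDyer.Rank1Residual.X11b Summit.BirchSwinnertonDyer.Rank1Residual.X11b.Levels
open scoped ContRepresentation

universe u

namespace Summit.BirchSwinnertonDyer.Rank1Residual.Additive.LevelBridge

variable {K : Type u} [Field K] (W : WeierstrassCurve K) [W.IsElliptic] (p : ℕ) [hp : Fact p.Prime]
  (hdiv : W.zsmul_geomPoints_surjective)

/-- **`H¹(ι_m)(κ_{p^m}(P)) = κ_m(P)`**: the level-`p^m` Kummer class of `P` (`kummerMapTorsion`,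
coefficients `E[p^m]`) pushed along `ι_m : E[p^m] ↪ E[p^∞]` (`primaryInclusion`) is the tree's
level-`m` Kummer class `kummerMapLevel` (coefficients `E[p^∞]`): both are represented by the cocycle
`σ ↦ σ•Q − Q` of the chosen root `Q`, and the class does not depend on the root
(`kummerMapLevel_eq_kummerClass`). [cite: SilvermanAEC2009, VIII.§2] [cite: GreenbergLNM1716, §2 p. 62] -/
theorem map_primaryInclusion_kummerMapTorsion_eq_kummerMapLevel (m : ℕ) (P : W.toAffine.Point) :
    galoisCohomology.map (primaryInclusion W p m) 1
        (kummerMapTorsion W ((p ^ m : ℕ) : ℤ)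
          (hdiv (show (((p ^ m : ℕ) : ℤ)) ≠ 0 by exact_mod_cast pow_ne_zero m hp.out.ne_zero)) P) =
      kummerMapLevel W p hdiv m P := by
  have hn : (((p ^ m : ℕ) : ℤ)) ≠ 0 := by exact_mod_cast pow_ne_zero m hp.out.ne_zero
  set Q := zsmulRoot W ((p ^ m : ℕ) : ℤ) (hdiv hn) P with hQ
  have hQP : ((p ^ m : ℕ) : ℤ) • Q = toGeomPoints W P := zsmul_zsmulRoot W _ (hdiv hn) P
  have hQP' : p ^ m • Q = toGeomPoints W P := by rw [← natCast_zsmul]; exact hQP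
  rw [kummerMapLevel_eq_kummerClass W p hdiv m P Q hQP']
  change galoisCohomology.map (primaryInclusion W p m) 1
      (kummerClassTorsion W ((p ^ m : ℕ) : ℤ) Q (zsmul_zsmulRoot_mem W _ (hdiv hn) P)) = _
  unfold kummerClassTorsion kummerClass
  erw [galoisCohomology.map_one_oneCocycleClass]
  congr 1

/-- **The compatible system**: `p • H¹(ι_{m+1})(κ_{p^{m+1}}(P)) = H¹(ι_m)(κ_{p^m}(P))` in
`H¹(K, E[p^∞])` (`κ_{m+1}(p•P) = κ_m(P)`, `kummerMapLevel_level`, and additivity of `κ_{m+1}` — all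
scalars live on cohomology or inside the Literature's general-`K` Kummer map).
[cite: GreenbergLNM1716, §2 p. 62] -/
theorem nsmul_map_primaryInclusion_kummerMapTorsion_succ (m : ℕ) (P : W.toAffine.Point) :
    p • galoisCohomology.map (primaryInclusion W p (m + 1)) 1
        (kummerMapTorsion W ((p ^ (m + 1) : ℕ) : ℤ)
          (hdiv (show (((p ^ (m + 1) : ℕ) : ℤ)) ≠ 0 by exact_mod_cast pow_ne_zero (m + 1) hp.out.ne_zero)) P) =
      galoisCohomology.map (primaryInclusion W p m) 1
        (kummerMapTorsion W ((p ^ m : ℕ) : ℤ)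
          (hdiv (show (((p ^ m : ℕ) : ℤ)) ≠ 0 by exact_mod_cast pow_ne_zero m hp.out.ne_zero)) P) := by
  rw [map_primaryInclusion_kummerMapTorsion_eq_kummerMapLevel, map_primaryInclusion_kummerMapTorsion_eq_kummerMapLevel,
    ← kummerMapLevel_level W p hdiv m 1 (m + 1) rfl P, pow_one, map_nsmul]
  rfl

/-- **`ord Ψ_m(κ_{p^m}(P)) = p^m` for a point that generates modulo `p^m`** in the sense of the (MW)
input `hord` of files 107/108 (`a·P ∈ p^m·W(K) ⟹ p^m ∣ a`), when `E[p^∞]^{Γ_K} = 0` (`Ψ_m` injective,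
`levelToLayerZero_injective`): `p^m` kills the class (`pow_smul_levelToLayerZero_eq_zero`), and
`p^j·Ψ_m(κ(P)) = Ψ_m(κ(p^j·P)) = 0` forces `p^j·P ∈ p^m·W(K)` (`kummerMapTorsion_ker`), so `m ≤ j`.
Step 1b of `HMW-COUNT-PLAN` (the orders of the compatible system for file 115).
[cite: SilvermanAEC2009, VIII.§2 (exactness of the Kummer sequence)] [cite: GreenbergLNM1716, §2 p. 63] -/
theorem addOrderOf_levelToLayerZero_kummerMapTorsion_eq [CharZero K] (κ : ZpExtension K p) (m : ℕ)
    (hΓ : ∀ Q : W.geomPrimaryTorsion p,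
      (∀ σ : Field.absoluteGaloisGroup K, X11b.LocBridge.primaryGaloisModule W p σ Q = Q) → Q = 0)
    (P : W.toAffine.Point)
    (hord : ∀ a : ℤ, a • P ∈ (zsmulAddGroupHom ((p ^ m : ℕ) : ℤ) : W.toAffine.Point →+ _).range →
      ((p ^ m : ℕ) : ℤ) ∣ a) :
    addOrderOf (resH1Hom (subgroupIncl (κ.layerSubgroup 0)) (AddMonoidHom.id (geomPrimaryTorsion W p))
        (fun _ _ ↦ rfl) (galoisCohomology.map (primaryInclusion W p m) 1
          (kummerMapTorsion W ((p ^ m : ℕ) : ℤ)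
            (hdiv (show (((p ^ m : ℕ) : ℤ)) ≠ 0 by exact_mod_cast pow_ne_zero m hp.out.ne_zero)) P))) =
      p ^ m := by
  haveI : PerfectField K := PerfectField.ofCharZero
  have hn : (((p ^ m : ℕ) : ℤ)) ≠ 0 := by exact_mod_cast pow_ne_zero m hp.out.ne_zero
  set κm := kummerMapTorsion W ((p ^ m : ℕ) : ℤ) (hdiv hn) with hκm
  set G := galoisCohomology.map (primaryInclusion W p m) 1 with hG
  set Φ := resH1Hom (subgroupIncl (κ.layerSubgroup 0)) (AddMonoidHom.id (geomPrimaryTorsion W p))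
    (fun _ _ ↦ rfl) with hΦ
  set c := κm P with hc
  have hkill : p ^ m • Φ (G c) = 0 := pow_smul_levelToLayerZero_eq_zero W p κ m c
  -- the order is `p^j` with `j ≤ m`
  obtain ⟨j, hjm, hj⟩ := (Nat.dvd_prime_pow hp.out).mp (addOrderOf_dvd_of_nsmul_eq_zero hkill)
  rw [hj]
  -- `p^j • Ψ_m(c) = 0`, so `Ψ_m(κ(p^j • P)) = 0`, so `κ(p^j • P) = 0` (term-mode additivity; no `rw` under `Φ`)
  have h0 : p ^ j • Φ (G c) = 0 := by rw [← hj]; exact addOrderOf_nsmul_eq_zero _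
  have e1 : κm (p ^ j • P) = p ^ j • c := map_nsmul κm (p ^ j) P
  have h1 : Φ (G (κm (p ^ j • P))) = Φ (G 0) :=
    (((congrArg (fun z ↦ Φ (G z)) e1).trans ((congrArg Φ (map_nsmul G (p ^ j) c)).trans
      (map_nsmul Φ (p ^ j) (G c)))).trans h0).trans ((congrArg Φ (map_zero G)).trans (map_zero Φ)).symm
  have h2 : κm (p ^ j • P) = 0 := levelToLayerZero_injective W p κ m hΓ h1
  -- hence `p^j • P ∈ p^m W(K)` and `p^m ∣ p^j`
  have h3 : (p ^ j • P) ∈ (zsmulAddGroupHom ((p ^ m : ℕ) : ℤ) : W.toAffine.Point →+ _).range := by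
    rw [← kummerMapTorsion_ker W ((p ^ m : ℕ) : ℤ) (hdiv hn)]
    exact (AddMonoidHom.mem_ker).mpr h2
  have h4 : ((p ^ m : ℕ) : ℤ) ∣ ((p ^ j : ℕ) : ℤ) := hord _ (by rw [natCast_zsmul]; exact h3)
  have h5 : p ^ m ∣ p ^ j := by exact_mod_cast h4
  have hmj : m ≤ j := (Nat.pow_dvd_pow_iff_le_right hp.out.one_lt).mp h5
  rw [le_antisymm hjm hmj]

end Summit.BirchSwinnertonDyer.Rank1Residual.Additive.LevelBridge

end
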